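import Mathlib
import Summits.CriticalPhenomena.SAWScalingLimit.Theorems.SAWExcursionCardyCardyFSpecSeries
import Literature.Probability.RandomPlanarGeometry.GaussIncompleteBeta
import HarnessLib

/-!
# Euler's integral for `₂F₁(-1/2, 2; 7/2; u)`, `0 ≤ u < 1` — helper file 3 for item `CardyFSpec`
(route `SAWExcursionCardy`, stmt-CriticalPhenomena-4516)

**`₂F₁(-1/2, 2; 7/2; u) = (15/4) ∫₀¹ t √((1-t)(1-ut)) dt` for `u ∈ [0, 1)`** (`hyperg_eq_integral`),
Euler's integral representation `₂F₁(a,b;c;u) = Γ(c)/(Γ(b)Γ(c-b)) ∫₀¹ t^{b-1}(1-t)^{c-b-1}(1-ut)^{-a} dt`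
at `(a, b, c) = (-1/2, 2, 7/2)` (`Γ(7/2)/(Γ(2)Γ(3/2)) = 15/4`), whence the route's
`F(u) = (8/5) u ₂F₁ = 6u ∫₀¹ t√((1-t)(1-ut)) dt`. Proof (Andrews–Askey–Roy 1999, Thm 2.2.1):
expand `√(1-ut) = ∑ b_n uⁿ tⁿ`, `b_n = (-1/2)_n/n!` (the binomial series, tree lemma
`Literature.Probability.RandomPlanarGeometry.hasSum_binomCoeff`, from Mathlib's
`Real.one_div_one_sub_rpow_hasFPowerSeriesOnBall_zero`), integrate term-wise
(`intervalIntegral.hasSum_integral_of_dominated_convergence`, bound `|b_n| uⁿ`, summable for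
`u < 1`), evaluate `∫₀¹ t^{n+1}√(1-t) dt = Γ(n+2)Γ(3/2)/Γ(n+7/2)` (Euler's beta integral, tree
lemma `integral_betaKernel_eq_Gamma`) and recognise `(15/4) b_n Γ(n+2)Γ(3/2)/Γ(n+7/2) = c_n`
through `Γ(x+n) = (x)_n Γ(x)` (a local `have`). The endpoint `u = 1` is NOT treated here (there `F(1) = 1` is the
telescoping sum of helper file 1 and the integral is `6∫₀¹ t(1-t) dt = 1` directly).
No definitions.
-/

noncomputable section

open MeasureTheory Set Filter Topology intervalIntegral
open scoped Nat

namespace Summit.CriticalPhenomena.SAWScalingLimit.Theorems.CardyFSpec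

/-- **Euler's beta integral** `∫₀¹ t^{n+1} √(1-t) dt = Γ(n+2)Γ(3/2)/Γ(n+7/2)` (tree lemma
`integral_betaKernel_eq_Gamma` with `β = n+2`, `α = -1/2`). [cite: AndrewsAskeyRoy1999, Thm 1.1.4] -/
theorem integral_pow_succ_mul_sqrt (n : ℕ) :
    ∫ t in (0 : ℝ)..1, t ^ (n + 1) * Real.sqrt (1 - t) =
      Real.Gamma ((n : ℝ) + 2) * Real.Gamma (3 / 2) / Real.Gamma ((n : ℝ) + 7 / 2) := by
  have h := Literature.Probability.RandomPlanarGeometry.integral_betaKernel_eq_Gamma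
    (α := (-1 / 2 : ℝ)) (β := (n : ℝ) + 2) (by norm_num) (by positivity)
  have e1 : (1 : ℝ) - -1 / 2 = 3 / 2 := by norm_num
  have e2 : (n : ℝ) + 2 + 1 - -1 / 2 = n + 7 / 2 := by ring
  rw [e1, e2] at h
  rw [← h]
  refine intervalIntegral.integral_congr fun t _ ↦ ?_
  have e3 : (n : ℝ) + 2 - 1 = ((n + 1 : ℕ) : ℝ) := by push_cast; ring
  simp only [e3, Real.rpow_natCast, show -(-1 / 2 : ℝ) = 1 / 2 by norm_num, Real.sqrt_eq_rpow]

/-- The coefficient identity `(15/4) b_n Γ(n+2)Γ(3/2)/Γ(n+7/2) = c_n` (`b_n = (-1/2)_n/n!` the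
binomial coefficient of `√(1-x)`, `c_n` the Gauss coefficient of `₂F₁(-1/2,2;7/2;·)`), i.e.
`Γ(n+2) = (2)_n`, `Γ(n+7/2) = (7/2)_n (15/4) Γ(3/2)` through `Γ(x+n) = (x)_n Γ(x)` (Andrews–Askey–Roy
(1.1.6), tree lemma `Literature.NumberTheory.Automorphic.LegendreP.Gamma_add_nat_eq_ascPochhammer_mul`,
re-derived inline to keep the imports light). [folklore] -/
theorem binom_mul_beta_eq_coeff (n : ℕ) :
    15 / 4 * ((n ! : ℝ)⁻¹ * (ascPochhammer ℝ n).eval (-1 / 2 : ℝ)) *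
        (Real.Gamma ((n : ℝ) + 2) * Real.Gamma (3 / 2) / Real.Gamma ((n : ℝ) + 7 / 2)) =
      ordinaryHypergeometricCoefficient (-1 / 2 : ℝ) 2 (7 / 2) n := by
  -- `Γ(x + m) = (x)_m Γ(x)` for `x > 0`
  have hGamma : ∀ {x : ℝ}, 0 < x → ∀ m : ℕ,
      Real.Gamma (x + m) = (ascPochhammer ℝ m).eval x * Real.Gamma x := by
    intro x hx m
    induction m with
    | zero => simp
    | succ m ih =>
      have hxm : x + m ≠ 0 := by positivity
      rw [Nat.cast_succ, ← add_assoc, Real.Gamma_add_one hxm, ih, ascPochhammer_succ_eval]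
      ring
  have hG2 : Real.Gamma ((n : ℝ) + 2) = (ascPochhammer ℝ n).eval 2 := by
    rw [add_comm, hGamma two_pos n, Real.Gamma_two, mul_one]
  have hG7 : Real.Gamma ((n : ℝ) + 7 / 2) =
      (ascPochhammer ℝ n).eval (7 / 2) * (15 / 4 * Real.Gamma (3 / 2)) := by
    rw [add_comm, hGamma (by norm_num : (0 : ℝ) < 7 / 2) n]
    congr 1
    have h := hGamma (x := 3 / 2) (by norm_num) 2
    rw [show (3 / 2 : ℝ) + (2 : ℕ) = 7 / 2 by norm_num] at h
    rw [h, ascPochhammer_succ_eval, ascPochhammer_one, Polynomial.eval_X]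
    push_cast
    ring
  have hΓ : Real.Gamma (3 / 2) ≠ 0 := (Real.Gamma_pos_of_pos (by norm_num)).ne'
  have hP7 : (ascPochhammer ℝ n).eval (7 / 2 : ℝ) ≠ 0 :=
    (ascPochhammer_pos n (7 / 2 : ℝ) (by norm_num)).ne'
  have hfact : ((n ! : ℕ) : ℝ) ≠ 0 := by positivity
  rw [hG2, hG7]
  unfold ordinaryHypergeometricCoefficient
  field_simp

/-- **Euler's integral for `₂F₁(-1/2, 2; 7/2; u)`, `0 ≤ u < 1`**:
`₂F₁(-1/2, 2; 7/2; u) = (15/4) ∫₀¹ t √((1-t)(1-ut)) dt` (binomial series of `√(1-ut)` integrated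
term-wise against `t√(1-t)`, beta integrals). [cite: AndrewsAskeyRoy1999, Thm 2.2.1] -/
theorem hyperg_eq_integral {u : ℝ} (hu : u ∈ Set.Ico (0 : ℝ) 1) :
    ₂F₁ (-1 / 2 : ℝ) 2 (7 / 2) u =
      15 / 4 * ∫ t in (0 : ℝ)..1, t * Real.sqrt ((1 - t) * (1 - u * t)) := by
  have hu0 : 0 ≤ u := hu.1
  have hu1 : |u| < 1 := abs_lt.2 ⟨by linarith [hu.1], hu.2⟩
  -- the binomial series of `√(1-y)`, `|y| < 1`
  have hbin : ∀ y : ℝ, |y| < 1 →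
      HasSum (fun n ↦ (n ! : ℝ)⁻¹ * (ascPochhammer ℝ n).eval (-1 / 2 : ℝ) * y ^ n)
        (Real.sqrt (1 - y)) := by
    intro y hy
    have h := Literature.Probability.RandomPlanarGeometry.hasSum_binomCoeff (-1 / 2 : ℝ) hy
    have hy1 : 0 ≤ 1 - y := by linarith [(abs_lt.1 hy).2]
    have e : 1 / (1 - y) ^ (-1 / 2 : ℝ) = Real.sqrt (1 - y) := by
      rw [show (-1 / 2 : ℝ) = -(1 / 2) by norm_num, Real.rpow_neg hy1, one_div, inv_inv,
        Real.sqrt_eq_rpow]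
    rwa [e] at h
  set b : ℕ → ℝ := fun n ↦ (n ! : ℝ)⁻¹ * (ascPochhammer ℝ n).eval (-1 / 2 : ℝ) with hb
  -- the terms `G n t = b_n uⁿ t^{n+1} √(1-t)` and their sum
  set G : ℕ → ℝ → ℝ := fun n t ↦ b n * u ^ n * (t ^ (n + 1) * Real.sqrt (1 - t)) with hG
  have hsum_t : ∀ t ∈ Set.Icc (0 : ℝ) 1,
      HasSum (fun n ↦ G n t) (t * Real.sqrt ((1 - t) * (1 - u * t))) := by
    intro t ht
    have hy : |u * t| < 1 := by
      rw [abs_mul, abs_of_nonneg hu.1, abs_of_nonneg ht.1]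
      calc u * t ≤ u * 1 := mul_le_mul_of_nonneg_left ht.2 hu.1
        _ < 1 := by rw [mul_one]; exact hu.2
    have h := (hbin (u * t) hy).mul_left (t * Real.sqrt (1 - t))
    have e : t * Real.sqrt (1 - t) * Real.sqrt (1 - u * t) =
        t * Real.sqrt ((1 - t) * (1 - u * t)) := by
      rw [Real.sqrt_mul (by linarith [ht.2]), mul_assoc]
    rw [e] at h
    refine h.congr_fun fun n ↦ ?_
    simp only [hG]
    ring
  -- the summable bound `|b_n| uⁿ`
  have hbs : Summable (fun n ↦ |b n| * u ^ n) := by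
    have h := (hbin u hu1).summable.abs
    refine h.congr fun n ↦ ?_
    rw [abs_mul, abs_pow, abs_of_nonneg hu.1]
  -- term-wise integration
  have hint : HasSum (fun n ↦ ∫ t in (0 : ℝ)..1, G n t)
      (∫ t in (0 : ℝ)..1, t * Real.sqrt ((1 - t) * (1 - u * t))) := by
    refine intervalIntegral.hasSum_integral_of_dominated_convergence (fun n _ ↦ |b n| * u ^ n)
      (fun n ↦ ?_) (fun n ↦ ?_) ?_ ?_ ?_
    · have hc : Continuous (G n) := by
        simp only [hG]
        fun_prop
      exact hc.aestronglyMeasurable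
    · refine ae_of_all _ fun t ht ↦ ?_
      rw [uIoc_of_le zero_le_one] at ht
      simp only [hG]
      rw [Real.norm_eq_abs, abs_mul, abs_mul, abs_pow, abs_of_nonneg hu.1]
      refine mul_le_of_le_one_right (by positivity) ?_
      rw [abs_mul, abs_pow, abs_of_nonneg ht.1.le, abs_of_nonneg (Real.sqrt_nonneg _)]
      refine mul_le_one₀ (pow_le_one₀ ht.1.le ht.2) (Real.sqrt_nonneg _) ?_
      exact (Real.sqrt_le_sqrt (by linarith [ht.1])).trans_eq Real.sqrt_one
    · exact ae_of_all _ fun t _ ↦ hbs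
    · exact intervalIntegrable_const
    · refine ae_of_all _ fun t ht ↦ ?_
      rw [uIoc_of_le zero_le_one] at ht
      exact hsum_t t ⟨ht.1.le, ht.2⟩
  -- evaluate the term integrals
  have hGint : ∀ n, ∫ t in (0 : ℝ)..1, G n t =
      b n * u ^ n * (Real.Gamma ((n : ℝ) + 2) * Real.Gamma (3 / 2) / Real.Gamma ((n : ℝ) + 7 / 2)) := by
    intro n
    simp only [hG]
    rw [intervalIntegral.integral_const_mul, integral_pow_succ_mul_sqrt]
  have hseries : HasSum (fun n ↦ 4 / 15 *
      (ordinaryHypergeometricCoefficient (-1 / 2 : ℝ) 2 (7 / 2) n * u ^ n))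
      (∫ t in (0 : ℝ)..1, t * Real.sqrt ((1 - t) * (1 - u * t))) := by
    refine hint.congr_fun fun n ↦ ?_
    rw [hGint n, ← binom_mul_beta_eq_coeff n]
    simp only [hb]
    ring
  have hw := (hasSum_hyperg hu1.le).mul_left (4 / 15)
  rw [hseries.unique hw]
  ring

end Summit.CriticalPhenomena.SAWScalingLimit.Theorems.CardyFSpec
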